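import Summits.PneNP.PneNP.Theorems.SymmetryBudgetNoHiddenOrderBranchSumDefs

/-!
# BranchSum I: cells, the halving-chain lemma, Fact S, and the potential argument

Part A of the proof of CG84-FLATNESS.md Theorem 9.1 (abstract form, §9.3) for a `RefinementPath`
(see `SymmetryBudgetNoHiddenOrderBranchSumDefs.lean` for the setting and references):

* basic API of cells along the path (nesting H1 iterated);
* `card_le_log_of_halving` — a finite set of indices along which positive values `≤ g` halve has at
  most `Nat.log 2 g` elements (used twice: for the events of one vertex, and for nested fresh giants);
* **Fact S** `two_mul_swDeg_le` — in the switching-equivalent graph of an equitable partition every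
  vertex has at most `|C|/2` neighbours in every cell `C` (Laubner 2011, Def. 3.3.2 and eq. (N));
* **Part A** `sum_good_le` — with the potential "every vertex is removed or halved at most
  `Nat.log 2 |V|` times", the GOOD steps (`2Δ_k ≥ d_k`) satisfy `Σ_good d_k ≤ 2·|V|·Nat.log 2 |V|`.
-/

namespace Summit.PneNP.PneNP.Theorems

open Finset

namespace BranchSum

variable {V : Type*} [DecidableEq V] {G : SimpleGraph V} [DecidableRel G.Adj] {N : ℕ}

namespace RefinementPath

variable (R : RefinementPath G N)

/-! ### Basic API of cells -/

/-- Membership in a cell of node `k`. -/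
theorem mem_cell_iff {k : ℕ} {u v : V} : v ∈ R.cell k u ↔ v ∈ R.W k ∧ R.col k v = R.col k u :=
  mem_cellOf_iff

/-- A vertex of `W k` lies in its own cell. -/
theorem self_mem_cell {k : ℕ} {u : V} (hu : u ∈ R.W k) : u ∈ R.cell k u :=
  R.mem_cell_iff.2 ⟨hu, rfl⟩

/-- Cells of node `k` are subsets of `W k`. -/
theorem cell_subset_W (k : ℕ) (u : V) : R.cell k u ⊆ R.W k := filter_subset _ _

/-- A cell is the cell of each of its members. -/
theorem cell_eq_of_mem {k : ℕ} {u v : V} (hv : v ∈ R.cell k u) : R.cell k v = R.cell k u :=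
  cellOf_eq_of_mem hv

/-- H1a iterated: the vertex sets decrease. -/
theorem W_subset_of_le {k k' : ℕ} (h : k ≤ k') : R.W k' ⊆ R.W k := by
  induction h with
  | refl => exact Subset.rfl
  | step _ ih => exact (R.nest _).trans ih

/-- From node `N` on nothing is left. -/
theorem W_eq_empty_of_le {k : ℕ} (h : N ≤ k) : R.W k = ∅ :=
  subset_empty.1 (R.final ▸ R.W_subset_of_le h)

/-- A node with a vertex is before `N`. -/
theorem lt_N_of_mem {k : ℕ} {u : V} (hu : u ∈ R.W k) : k < N := by
  by_contra h
  rw [R.W_eq_empty_of_le (not_lt.1 h)] at hu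
  simp at hu

/-- H1b iterated: equal colours at a later node give equal colours earlier. -/
theorem col_eq_of_le {k k' : ℕ} (h : k ≤ k') {u v : V} (hu : u ∈ R.W k') (hv : v ∈ R.W k')
    (huv : R.col k' u = R.col k' v) : R.col k u = R.col k v := by
  induction h with
  | refl => exact huv
  | step hle ih =>
    exact ih (R.nest _ hu) (R.nest _ hv) (R.colNest _ u hu v hv huv)

/-- H1 iterated: cells at a later node lie inside cells at an earlier node. -/
theorem cell_subset_cell_of_le {k k' : ℕ} (h : k ≤ k') {u : V} (hu : u ∈ R.W k') :
    R.cell k' u ⊆ R.cell k u := by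
  intro v hv
  rw [mem_cell_iff] at hv ⊢
  exact ⟨R.W_subset_of_le h hv.1, R.col_eq_of_le h hv.1 hu hv.2⟩

/-- Cells shrink along the path. -/
theorem card_cell_le_of_le {k k' : ℕ} (h : k ≤ k') {u : V} (hu : u ∈ R.W k') :
    (R.cell k' u).card ≤ (R.cell k u).card :=
  card_le_card (R.cell_subset_cell_of_le h hu)

/-- Two cells of the same node are equal or disjoint. -/
theorem cell_eq_or_disjoint (k : ℕ) (u v : V) : R.cell k u = R.cell k v ∨ Disjoint (R.cell k u) (R.cell k v) := by
  by_cases h : R.col k u = R.col k v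
  · exact Or.inl (cellOf_eq_of_col_eq (W := R.W k) h.symm).symm
  · refine Or.inr (disjoint_left.2 fun w hw hw' => h ?_)
    rw [mem_cell_iff] at hw hw'
    rw [← hw.2, hw'.2]

/-! ### The halving-chain counting lemma -/

/-- If the values `s j` along a finite set of indices are `≥ 2`, `≤ g`, and at least halve from each
index to every later one, then there are at most `Nat.log 2 g` indices. -/
theorem pow_card_le_of_halving (F : Finset ℕ) (s : ℕ → ℕ) (h2 : ∀ j ∈ F, 2 ≤ s j)
    (hhalf : ∀ j ∈ F, ∀ j' ∈ F, j < j' → 2 * s j' ≤ s j) :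
    ∀ j ∈ F, (∀ j' ∈ F, j ≤ j') → 2 ^ F.card ≤ s j := by
  induction F using Finset.induction_on_min with
  | empty => intro j hj; simp at hj
  | insert a F ha ih =>
    intro j hj hmin
    have hja : j = a := by
      rcases mem_insert.1 hj with h | h
      · exact h
      · exact absurd (hmin a (mem_insert_self a F)) (not_le.2 (ha j h))
    subst hja
    have haF : j ∉ F := fun h => lt_irrefl j (ha j h)
    rw [card_insert_of_notMem haF, pow_succ]
    rcases F.eq_empty_or_nonempty with hF | hF
    · subst hF; simpa using h2 j hj
    · obtain ⟨m, hmF, hmmin⟩ := F.exists_min_image id hF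
      have ihm : 2 ^ F.card ≤ s m :=
        ih (fun x hx => h2 x (mem_insert_of_mem hx))
          (fun x hx y hy hxy => hhalf x (mem_insert_of_mem hx) y (mem_insert_of_mem hy) hxy) m hmF
          (fun j' hj' => hmmin j' hj')
      have hstep : 2 * s m ≤ s j := hhalf j hj m (mem_insert_of_mem hmF) (ha m hmF)
      calc 2 ^ F.card * 2 = 2 * 2 ^ F.card := Nat.mul_comm _ _
        _ ≤ 2 * s m := Nat.mul_le_mul_left 2 ihm
        _ ≤ s j := hstep

/-- If the values `s j` along a finite set of indices are `≥ 2`, `≤ g`, and at least halve from each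
index to every later one, then there are at most `Nat.log 2 g` indices. -/
theorem card_le_log_of_halving (F : Finset ℕ) (s : ℕ → ℕ) (g : ℕ) (h2 : ∀ j ∈ F, 2 ≤ s j)
    (hg : ∀ j ∈ F, s j ≤ g) (hhalf : ∀ j ∈ F, ∀ j' ∈ F, j < j' → 2 * s j' ≤ s j) :
    F.card ≤ Nat.log 2 g := by
  rcases F.eq_empty_or_nonempty with hF | hF
  · simp [hF]
  · obtain ⟨m, hmF, hmmin⟩ := F.exists_min_image id hF
    have h := pow_card_le_of_halving F s h2 hhalf m hmF (fun j' hj' => hmmin j' hj')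
    exact Nat.le_log_of_pow_le (by norm_num) (h.trans (hg m hmF))

/-! ### Fact S: switching degrees are at most half a cell -/

/-- `blockEdges` counted fibrewise: with an equitable partition it is `|cell u| · rowdeg(u → cell v)`. -/
theorem blockEdges_eq (k : ℕ) {u : V} (hu : u ∈ R.W k) (v : V) (hv : v ∈ R.W k) :
    blockEdges G (R.W k) (R.col k) u v = (R.cell k u).card * ((R.cell k v).filter fun y => G.Adj u y).card := by
  unfold blockEdges
  rw [card_filter, sum_product]
  have : ∀ a ∈ R.cell k u, (∑ b ∈ R.cell k v, if G.Adj (a, b).1 (a, b).2 then 1 else 0) =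
      ((R.cell k v).filter fun y => G.Adj u y).card := by
    intro a ha
    rw [← card_filter]
    have ha' := R.mem_cell_iff.1 ha
    exact R.equitable k a ha'.1 u hu ha'.2 v hv
  rw [sum_congr rfl this, sum_const, smul_eq_mul]

/-- **Fact S.** In the switching-equivalent graph every vertex has at most `|C|/2` neighbours in every
cell `C` (other than itself). -/
theorem two_mul_swDeg_le (k : ℕ) {u : V} (hu : u ∈ R.W k) {v : V} (hv : v ∈ R.W k) :
    2 * ((R.cell k v).filter fun y => (R.sw k).Adj u y).card ≤ (R.cell k v).card := by
  set C := R.cell k v with hC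
  set r := (C.filter fun y => G.Adj u y).card with hr
  have hpos : 0 < (R.cell k u).card := card_pos.2 ⟨u, R.self_mem_cell hu⟩
  have hbe := R.blockEdges_eq k hu v hv
  have hrC : r + (C.filter fun y => ¬ G.Adj u y).card = C.card := card_filter_add_card_filter_not _
  -- the complementing decision is the same for every `y ∈ C`
  have hcongr : ∀ y ∈ C, (SwComp G (R.W k) (R.col k) u y ↔ SwComp G (R.W k) (R.col k) u v) := fun y hy =>
    swComp_congr G rfl (R.mem_cell_iff.1 hy).2
  by_cases hcomp : SwComp G (R.W k) (R.col k) u v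
  · -- complemented block: sw-neighbours are non-neighbours, and `|C| < 2 r`
    have hlt : C.card < 2 * r := by
      have h' : (R.cell k u).card * C.card < (R.cell k u).card * (2 * r) := by
        have := hcomp; unfold SwComp at this; rw [hbe] at this
        simpa [hC, hr, Nat.mul_assoc, Nat.mul_left_comm] using this
      exact Nat.lt_of_mul_lt_mul_left h'
    have hsub : (C.filter fun y => (R.sw k).Adj u y) ⊆ C.filter fun y => ¬ G.Adj u y := by
      intro y hy
      rw [mem_filter] at hy ⊢
      refine ⟨hy.1, ?_⟩
      have hadj := (swGraph_adj G).1 hy.2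
      exact (hadj.2.trans (by rfl)).1 ((hcongr y hy.1).2 hcomp)
    have := card_le_card hsub
    omega
  · -- kept block: sw-neighbours are neighbours, and `2 r ≤ |C|`
    have hle : 2 * r ≤ C.card := by
      have h' : ¬ (R.cell k u).card * C.card < (R.cell k u).card * (2 * r) := by
        intro h''; apply hcomp; unfold SwComp; rw [hbe]
        simpa [hC, hr, Nat.mul_assoc, Nat.mul_left_comm] using h''
      have h3 : (R.cell k u).card * (2 * r) ≤ (R.cell k u).card * C.card := not_lt.1 h'
      exact Nat.le_of_mul_le_mul_left h3 hpos
    have hsub : (C.filter fun y => (R.sw k).Adj u y) ⊆ C.filter fun y => G.Adj u y := by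
      intro y hy
      rw [mem_filter] at hy ⊢
      refine ⟨hy.1, ?_⟩
      have hadj := (swGraph_adj G).1 hy.2
      by_contra hna
      exact hcomp ((hcongr y hy.1).1 (hadj.2.2 hna))
    have := card_le_card hsub
    omega

/-! ### Part A: the potential argument — good steps -/

section Counting

variable [Fintype V]

/-- Each vertex is removed or halved at most `Nat.log 2 |V|` times along the path. -/
theorem card_events_le (u : V) :
    ((range N).filter fun k => u ∈ R.W k ∧ R.Event k u).card ≤ Nat.log 2 (Fintype.card V) := by
  apply card_le_log_of_halving _ (fun k => (R.cell k u).card)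
  · intro j hj
    simp only [mem_filter, mem_range] at hj
    exact R.two_le j u hj.2.1
  · intro j _
    exact card_le_univ _
  · intro j hj j' hj' hlt
    simp only [mem_filter, mem_range] at hj hj'
    have hu1 : u ∈ R.W (j + 1) := R.W_subset_of_le (Nat.succ_le_of_lt hlt) hj'.2.1
    have hhalf : 2 * (R.cell (j + 1) u).card ≤ (R.cell j u).card := by
      rcases hj.2.2 with h | h
      · exact absurd hu1 h
      · exact h
    calc 2 * (R.cell j' u).card ≤ 2 * (R.cell (j + 1) u).card :=
          Nat.mul_le_mul_left 2 (R.card_cell_le_of_le (Nat.succ_le_of_lt hlt) hj'.2.1)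
      _ ≤ _ := hhalf

/-- A filtered cardinality as a sum of indicators over all vertices. -/
theorem card_filter_eq_sum_univ (s : Finset V) (p : V → Prop) [DecidablePred p] :
    (s.filter p).card = ∑ u, if u ∈ s ∧ p u then 1 else 0 := by
  rw [card_eq_sum_ones, sum_filter]
  have h1 : ∑ u ∈ s, (if p u then 1 else 0) = ∑ u ∈ s, (if u ∈ s ∧ p u then 1 else 0) :=
    sum_congr rfl fun u hu => by simp [hu]
  rw [h1]
  exact sum_subset (subset_univ s) fun u _ hu => by simp [hu]

/-- Double counting: total progress = total number of (vertex, event) pairs. -/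
theorem sum_delta_eq :
    ∑ k ∈ range N, R.delta k = ∑ u : V, ((range N).filter fun k => u ∈ R.W k ∧ R.Event k u).card := by
  unfold delta
  simp_rw [card_filter_eq_sum_univ]
  rw [sum_comm]
  refine sum_congr rfl fun u _ => ?_
  rw [card_eq_sum_ones, sum_filter]

/-- The total progress along the path is at most `|V| · Nat.log 2 |V|`. -/
theorem sum_delta_le : ∑ k ∈ range N, R.delta k ≤ Fintype.card V * Nat.log 2 (Fintype.card V) := by
  rw [sum_delta_eq]
  calc ∑ u : V, ((range N).filter fun k => u ∈ R.W k ∧ R.Event k u).card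
      ≤ ∑ _u : V, Nat.log 2 (Fintype.card V) := sum_le_sum fun u _ => R.card_events_le u
    _ = Fintype.card V * Nat.log 2 (Fintype.card V) := by simp [sum_const, card_univ]

/-- **Good steps are paid by the potential:** `Σ_{good k} d k ≤ 2 |V| log₂ |V|`. -/
theorem sum_good_le :
    ∑ k ∈ (range N).filter (fun k => ¬ R.Bad k), R.d k ≤ 2 * (Fintype.card V * Nat.log 2 (Fintype.card V)) := by
  calc ∑ k ∈ (range N).filter (fun k => ¬ R.Bad k), R.d k
      ≤ ∑ k ∈ (range N).filter (fun k => ¬ R.Bad k), 2 * R.delta k :=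
        sum_le_sum fun k hk => not_lt.1 (by simpa [Bad] using (mem_filter.1 hk).2)
    _ ≤ ∑ k ∈ range N, 2 * R.delta k :=
        sum_le_sum_of_subset_of_nonneg (filter_subset _ _) fun _ _ _ => Nat.zero_le _
    _ = 2 * ∑ k ∈ range N, R.delta k := by rw [mul_sum]
    _ ≤ 2 * (Fintype.card V * Nat.log 2 (Fintype.card V)) := Nat.mul_le_mul_left 2 R.sum_delta_le

end Counting


end RefinementPath

end BranchSum

end Summit.PneNP.PneNP.Theorems
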